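import Literature.AlgebraicGeometry.Motives.CurveDiagonalFibre
import Literature.AlgebraicGeometry.RelativeSpec.SymmetricPower
import HarnessLib

/-!
# The universal divisor `D = Σᵢ Δ_{0i}` on `C × Cᵍ` and its fibres `D_t ∼ Σᵢ [tᵢ]`
# (Milne, *Jacobian Varieties*, §3 Example 3.12)

For a smooth proper geometrically integral curve `C / K` and `g : ℕ`, let `Cᵍ = C ×_K ⋯ ×_K C`
(`powC C g : SchemeOver K`, the wide fibre product `powOverObj C.hom g` of
`RelativeSpec/SymmetricPower`; integral and locally of finite type, `isIntegral_powOver_hom`) with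
coordinates `coord C g i : Cᵍ → C`. On `C × Cᵍ = (C ⊗ powC C g).left` (integral:
`isIntegral_tensor_powC_left`) this file defines **the universal divisor**
`univDivisor C g = Σᵢ pr_{0,i}^* Δ` (Milne's `D = Σ Dᵢ`, `Dᵢ = sᵢ(Cʳ)`; here as the sum of the
divisor-class pullbacks `classPullback` of the diagonal divisor `Δ` of `Motives/CurveDiagonalDivisor`
along `prC C g i = (C ◁ coord i).left`, a representative of the class of `𝒪(Σᵢ Δ_{0i})`), and
computes its fibres over the points `t ∈ Cᵍ` in the form consumed by the semicontinuity theorem of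
`Motives/CechPseudoCoherentAt` (`isClosed_setOf_le_h0`: `h⁰` of `D.classPullback (C ◁ residuePtι T t).left`
over `κ(t)`):

* `CartierDivisor.sumDivisor`, `sumDivisor_linEquiv`, `classPullback_zero_linEquiv`,
  `classPullback_sumDivisor_linEquiv`; `toDivisor_zero`, `toDivisor_sumDivisor` (on a curve);
* `coordPt C g t i : Spec κ(t) → C` — the `i`-th coordinate of `t` as a `κ(t)`-valued point;
  `whisker_residuePtι_prC` (`C_{κ(t)} → C × Cᵍ → C × C` is the fibre inclusion `C × {tᵢ} ↪ C × C`);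
* **`univDivisor_fibre_linEquiv`** — `D_t ∼ Σᵢ Δ|_{C × {tᵢ}}` (functoriality of `classPullback` and
  `diagonalFibre_linEquiv_classPullback` of `Motives/CurveDiagonalFibre`);
* `toDivisor_sumDivisor_diagonalFibre` — `= Σᵢ place(tᵢ)` in `Div(κ(t)(C)/κ(t))`;
* **`h0_univDivisor_fibre : h⁰(D_t) = ℓ(Σᵢ tᵢ)`** — the dimension over `κ(t)` of
  `Γ(C_{κ(t)}, 𝒪(D_t))` is the Riemann–Roch dimension of the divisor `Σᵢ tᵢ` of the function field of
  the fibre `C_{κ(t)}` (`LinEquiv.h0_eq`, `h0_eq_ell`), for EVERY point `t` (coordinates with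
  inseparable residue fields included).

Everything is proved; no named facts (D-0026). Step (β3) of the construction of the Jacobian
(`nonempty_jacobian_of_isSmoothProjective`): with Riemann–Roch on `C_{κ(t)}` and semicontinuity this
gives the open `{t : h⁰(Σ tᵢ) = 1} ⊆ Cᵍ` of Milne §4 (Prop. 4.2 (a)).

Mathlib searched (pin): `Limits.WidePullback.π_arrow`, `pullbackSymmetry`,
`MonoidalCategory.whiskerLeft_comp`, `Fin.sum_univ_succ` (all used).

## References

* J. S. Milne, *Jacobian Varieties*, in: Arithmetic Geometry (Cornell–Silverman, eds.), Springer
  1986, §3 Example 3.12, §4 Prop. 4.2 (pp. 246–249 of the volume). [Milne1986JacobianVarieties]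
-/

noncomputable section

open CategoryTheory CategoryTheory.Limits AlgebraicGeometry IsLocalRing Order TopologicalSpace
  MonoidalCategory CartesianMonoidalCategory

universe u

namespace Literature.AlgebraicGeometry.Motives

open Literature.AlgebraicGeometry.RelativeSpec

/-! ### Finite sums of Cartier divisors -/

namespace CartierDivisor

open RatFn

variable {X : Scheme.{u}} [IsIntegral X]

/-- The sum `D₀ + (D₁ + (⋯ + (D_{n-1} + 0)))` of a finite family of Cartier divisors. [folklore] -/
def sumDivisor : {n : ℕ} → (Fin n → CartierDivisor X) → CartierDivisor X
  | 0, _ => 0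
  | _ + 1, D => D 0 + sumDivisor (fun i ↦ D i.succ)

/-- The empty sum is `0`. [folklore] -/
@[simp] theorem sumDivisor_zero (D : Fin 0 → CartierDivisor X) : sumDivisor D = 0 := rfl

/-- `Σ_{i<n+1} Dᵢ = D₀ + Σ_{i<n} D_{i+1}`. [folklore] -/
theorem sumDivisor_succ {n : ℕ} (D : Fin (n + 1) → CartierDivisor X) :
    sumDivisor D = D 0 + sumDivisor (fun i ↦ D i.succ) := rfl

/-- `sumDivisor` respects linear equivalence termwise. [folklore] -/
theorem sumDivisor_linEquiv : {n : ℕ} → {D E : Fin n → CartierDivisor X} →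
    (∀ i, (D i).LinEquiv (E i)) → (sumDivisor D).LinEquiv (sumDivisor E)
  | 0, _, _, _ => LinEquiv.refl _
  | _ + 1, _, _, h => (h 0).add (sumDivisor_linEquiv fun i ↦ h i.succ)

variable {Y : Scheme.{u}} [IsIntegral Y] (g : Y ⟶ X)

/-- The class pullback of the zero divisor is linearly equivalent to zero. [folklore] -/
theorem classPullback_zero_linEquiv : ((0 : CartierDivisor X).classPullback g).LinEquiv 0 := by
  refine (classPullback_linEquiv_pullbackAvoiding g 0 (avoids_zero _)).trans (SameDivisor.linEquiv ?_)
  intro i j y _ _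
  change IsUnitAt y (pullbackFn g 1 / 1)
  rw [pullbackFn_one, div_one]
  exact isUnitAt_one

/-- The class pullback of a finite sum is the sum of the class pullbacks (up to linear equivalence). [folklore] -/
theorem classPullback_sumDivisor_linEquiv : {n : ℕ} → (D : Fin n → CartierDivisor X) →
    ((sumDivisor D).classPullback g).LinEquiv (sumDivisor fun i ↦ (D i).classPullback g)
  | 0, _ => classPullback_zero_linEquiv g
  | _ + 1, _ => (classPullback_add_linEquiv g _ _).trans
      ((LinEquiv.refl _).add (classPullback_sumDivisor_linEquiv _))

end CartierDivisor

namespace CurvePlaces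

open RatFn FieldPoint CartierDivisor

variable {K : Type u} [Field K]

/-! ### `toDivisor` of finite sums on a curve -/

section SumCurve

variable (C : SchemeOver K) [IsIntegral C.left] [SmoothOfRelativeDimension 1 C.hom] [IsProper C.hom]

/-- `toDivisor 0 = 0`. [folklore] -/
theorem toDivisor_zero : toDivisor C (0 : CartierDivisor C.left) = 0 := by
  ext v; simp [CartierDivisor.ordAt_zero]

/-- `toDivisor (Σᵢ Dᵢ) = Σᵢ toDivisor Dᵢ`. [folklore] -/
theorem toDivisor_sumDivisor : {n : ℕ} → (D : Fin n → CartierDivisor C.left) →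
    toDivisor C (sumDivisor D) = ∑ i, toDivisor C (D i)
  | 0, _ => by simp [toDivisor_zero]
  | n + 1, D => by
    rw [sumDivisor_succ, toDivisor_add, toDivisor_sumDivisor, Fin.sum_univ_succ]

end SumCurve

/-! ### Powers of the curve -/

section Powers

variable (C : SchemeOver K) [IsIntegral C.left] [SmoothOfRelativeDimension 1 C.hom] [IsProper C.hom]
  [GeometricallyIntegral C.hom]

omit [IsIntegral C.left] in
/-- `Cⁿ` is integral and locally of finite type over `K` (`C` geometrically integral). [folklore] -/
theorem isIntegral_powOver_hom :
    ∀ n, IsIntegral (powOver C.hom n) ∧ LocallyOfFiniteType (powOver.base C.hom n)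
  | 0 => by
    haveI : IsIso (powOver.base C.hom 0) := inferInstance
    exact ⟨IsIntegral.of_isIso (inv (powOver.base C.hom 0)), inferInstance⟩
  | n + 1 => by
    obtain ⟨h1, h2⟩ := isIntegral_powOver_hom n
    haveI := h1
    haveI := h2
    haveI : IsLocallyNoetherian (powOver C.hom n) :=
      LocallyOfFiniteType.isLocallyNoetherian (powOver.base C.hom n)
    haveI : LocallyOfFinitePresentation C.hom := inferInstance
    haveI : UniversallyOpen C.hom := inferInstance
    haveI : IsIntegral (pullback (powOver.base C.hom n) C.hom) := inferInstance
    refine ⟨IsIntegral.of_isIso (powSuccIso C.hom n).inv, ?_⟩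
    rw [← powSuccIso_hom_fst_base]
    infer_instance

/-- **The power `Cᵍ`** as a `K`-scheme (the wide fibre product `C ×_K ⋯ ×_K C`). [folklore] -/
abbrev powC (g : ℕ) : SchemeOver K := powOverObj C.hom g

/-- `Cᵍ` is integral. [folklore] -/
instance isIntegral_powC_left (g : ℕ) : IsIntegral (powC C g).left := (isIntegral_powOver_hom C g).1

/-- `Cᵍ → Spec K` is locally of finite type. [folklore] -/
instance locallyOfFiniteType_powC_hom (g : ℕ) : LocallyOfFiniteType (powC C g).hom :=
  (isIntegral_powOver_hom C g).2

/-- `Cᵍ` is locally noetherian. [folklore] -/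
instance isLocallyNoetherian_powC_left (g : ℕ) : IsLocallyNoetherian (powC C g).left :=
  LocallyOfFiniteType.isLocallyNoetherian (powC C g).hom

/-- `C × Cᵍ` is integral. [folklore] -/
instance isIntegral_tensor_powC_left (g : ℕ) : IsIntegral (C ⊗ powC C g).left := by
  haveI : LocallyOfFinitePresentation C.hom := inferInstance
  haveI : UniversallyOpen C.hom := inferInstance
  haveI : IsIntegral (pullback (powC C g).hom C.hom) := inferInstance
  change IsIntegral (pullback C.hom (powC C g).hom)
  exact IsIntegral.of_isIso (pullbackSymmetry (powC C g).hom C.hom).hom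

/-- The `i`-th coordinate `Cᵍ → C` as a `K`-morphism. [folklore] -/
def coord (g : ℕ) (i : Fin g) : powC C g ⟶ C :=
  Over.homMk (powOver.proj C.hom g i) (WidePullback.π_arrow _ _)

omit [IsIntegral C.left] [SmoothOfRelativeDimension 1 C.hom] [IsProper C.hom] [GeometricallyIntegral C.hom] in
/-- The scheme morphism underlying `coord` is the wide-pullback projection. [folklore] -/
@[simp] theorem coord_left (g : ℕ) (i : Fin g) : (coord C g i).left = powOver.proj C.hom g i := rfl

/-- The projection `pr_{0,i} : C × Cᵍ → C × C` onto the factors `0` and `i`. [folklore] -/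
def prC (g : ℕ) (i : Fin g) : (C ⊗ powC C g).left ⟶ (C ⊗ C).left := (C ◁ coord C g i).left

/-- **The universal divisor `D = Σᵢ pr_{0,i}^* Δ` on `C × Cᵍ`** (a representative of its class:
the class pullbacks of the diagonal; Milne, *Jacobian Varieties*, Example 3.12: `D = Σ Dᵢ`,
`Dᵢ = sᵢ(Cʳ)` the graph of the `i`-th coordinate). [cite: Milne1986JacobianVarieties, §3 Example 3.12] -/
def univDivisor (g : ℕ) : CartierDivisor (C ⊗ powC C g).left :=
  sumDivisor fun i ↦ (diagonalDivisor C).classPullback (prC C g i)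

end Powers

/-! ### The fibres `D_t ∼ Σᵢ [tᵢ]` -/

section Fibres

variable (C : SchemeOver K) [IsIntegral C.left] [SmoothOfRelativeDimension 1 C.hom] [IsProper C.hom]
  [GeometricallyIntegral C.hom] (g : ℕ) (t : (powC C g).left)

/-- The `i`-th coordinate of the point `t ∈ Cᵍ`, as a `κ(t)`-valued point of `C`. [folklore] -/
def coordPt (i : Fin g) : residuePt (powC C g) t ⟶ C := residuePtι (powC C g) t ≫ coord C g i

omit [IsIntegral C.left] [SmoothOfRelativeDimension 1 C.hom] [IsProper C.hom] [GeometricallyIntegral C.hom] in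
/-- The fibre inclusion followed by `pr_{0,i}` is the fibre inclusion of `C × {tᵢ}`. [folklore] -/
theorem whisker_residuePtι_prC (i : Fin g) :
    (C ◁ residuePtι (powC C g) t).left ≫ prC C g i =
      fibreIncl C (residuePt (powC C g) t).hom (coordPt C g t i) := by
  change (C ◁ residuePtι (powC C g) t ≫ C ◁ coord C g i).left = (C ◁ coordPt C g t i).left
  rw [← MonoidalCategory.whiskerLeft_comp]
  rfl

/-- **`D_t ∼ Σᵢ Δ|_{C × {tᵢ}}`**: the restriction of the universal divisor to the fibre over
`t ∈ Cᵍ` is linearly equivalent to the sum of the fibre divisors of the coordinates. [cite: Milne1986JacobianVarieties, §3 Example 3.12] -/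
theorem univDivisor_fibre_linEquiv :
    ((univDivisor C g).classPullback (C ◁ residuePtι (powC C g) t).left).LinEquiv
      (sumDivisor fun i ↦ diagonalFibre C (residuePt (powC C g) t).hom (coordPt C g t i)) := by
  refine (classPullback_sumDivisor_linEquiv _ _).trans (sumDivisor_linEquiv fun i ↦ ?_)
  refine ((diagonalDivisor C).classPullback_comp_linEquiv (prC C g i)
    (C ◁ residuePtι (powC C g) t).left).symm.trans ?_
  rw [whisker_residuePtι_prC]
  exact (diagonalFibre_linEquiv_classPullback C _ _).symm

/-- The curve `C_{κ(t)}` over the residue field of `t`. [folklore] -/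
abbrev fibreCurve : SchemeOver ((powC C g).left.residueField t) := curveBC C (residuePt (powC C g) t).hom

/-- **`toDivisor` of the fibre**: `Σᵢ place(tᵢ)`. [cite: Milne1986JacobianVarieties, §3 Example 3.12] -/
theorem toDivisor_sumDivisor_diagonalFibre :
    toDivisor (fibreCurve C g t) (sumDivisor fun i ↦ diagonalFibre C (residuePt (powC C g) t).hom (coordPt C g t i)) =
      ∑ i, Finsupp.single (place (fibreCurve C g t)
        (ratPtPoint C (residuePt (powC C g) t).hom (coordPt C g t i))
        (ratPtPoint_ne_genericPoint C _ _)) 1 := by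
  rw [toDivisor_sumDivisor]
  refine Finset.sum_congr rfl fun i _ ↦ ?_
  exact toDivisor_diagonalFibre C _ _

/-- **`h⁰(D_t) = ℓ(Σᵢ tᵢ)`**: the dimension over `κ(t)` of the global sections of `𝒪(D_t)` on the
fibre `C_{κ(t)}` is the Riemann–Roch dimension of the divisor `Σᵢ tᵢ` of its function field
(`h0_eq_ell` of `Motives/CurveDivisorsFunctionField`). [cite: Milne1986JacobianVarieties, §3 Example 3.12 and §4 (proof of Prop. 4.2)] -/
theorem h0_univDivisor_fibre :
    letI := fibreOverResidueField C (powC C g) t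
    ((univDivisor C g).classPullback (C ◁ residuePtι (powC C g) t).left).h0 ((powC C g).left.residueField t) =
      Literature.NumberTheory.DiophantineGeometry.AlgFunctionField.ell
        (∑ i, Finsupp.single (place (fibreCurve C g t)
          (ratPtPoint C (residuePt (powC C g) t).hom (coordPt C g t i))
          (ratPtPoint_ne_genericPoint C _ _)) 1) := by
  letI := fibreOverResidueField C (powC C g) t
  rw [(univDivisor_fibre_linEquiv C g t).h0_eq (K := (powC C g).left.residueField t),
    ← toDivisor_sumDivisor_diagonalFibre]
  exact h0_eq_ell (C := fibreCurve C g t) _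

end Fibres

end CurvePlaces

end Literature.AlgebraicGeometry.Motives
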